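import Summits.SmoothPoincare4.SmoothPoincare4.Theses.ZeroSurgeryExotic
import Summits.SmoothPoincare4.SmoothPoincare4.Theorems.ZseSVanishesOnPairs.Negative.Position
import Literature.Topology.FourManifolds.RasmussenConcordanceProofs
import Summits.SmoothPoincare4.SmoothPoincare4.Theorems.ZeroSurgeryExoticAssembly2Record

/-!
(buildfix 2026-08-20: `Assembly2` was dropped from the gate-written route file by the items-cap autofix of
2026-08-16; its verbatim record `Theorems/ZeroSurgeryExoticAssembly2Record` is now imported — no declaration changed.)

# The kill switch `Assembly2` ("the `0`-surgery type determines sliceness"): its exact position (support lemmas for item stmt-SmoothPoincare4-0367)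

Route `SmoothPoincare4/ZeroSurgeryExotic`, item stmt-SmoothPoincare4-0367, decl
`Summit.SmoothPoincare4.SmoothPoincare4.Theses.ZeroSurgeryExotic.Assembly2`:

> `∀ K K' Y, IsIntegralSurgery (𝓡 3) Y K 0 → IsIntegralSurgery (𝓡 3) Y K' 0 → K.IsSmoothlySlice → K'.IsSmoothlySlice`
> — for knots `K, K' ⊂ S³` with a common `0`-surgery `Y`, if `K` is smoothly slice then so is `K'`.

The item is kinded `assembly` by the legacy decl-name rule only: it is NOT a hypothesis of the route's
deciding theorem `closes (hX : ZseThesis) (hA : Assembly)`; the route thesis calls it the KILL SWITCH. It is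
OPEN as filed. This file records, as theorems over the tree's discharged lemmas, exactly where it sits:

* `assembly2_iff_not_zseThesis`, `not_zseThesis_of_assembly2` — it is LITERALLY the negation of the route
  target `ZseThesis` (item stmt-SmoothPoincare4-0364): a proof closes the route `refuted:ZseThesis` (the
  thesis' kill criterion, here a theorem), a refutation proves the target — and with it the waypoint
  `ZseHsliceNotSlice` (`Theorems.ZseHsliceNotSlice.of_zseThesis`, file
  `ZeroSurgeryExoticZseHsliceNotSlicePosition.lean`) and `¬ SmoothPoincare4` (`Theorems.assembly_proof`, the
  route's assembly item 0365, file `ZeroSurgeryExoticAssembly.lean`), both already in the tree.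
* `isConcordant_friend_of_smoothPoincare4`, `assembly2_of_smoothPoincare4` — **the summit statement
  implies the item**: on a `0`-surgery pair with `K` slice, `K'` is slice in a homotopy `4`-ball
  (Manolescu–Piccirillo 2023, Lemma 3.3 for `W = S⁴`, PROVED in the tree,
  `Knot.ManolescuPiccirillo2023_lemma33_sphere_holds`) hence slice under `SmoothPoincare4`
  (Freedman–Gompf–Morrison–Walker, PROVED in the tree via Palais' disc theorem), hence concordant to `K`.
  So the item holds CONDITIONALLY on the summit conjecture — and on nothing weaker that is in print: only
  the `0`-TRACE analogue is a theorem (the trace embedding lemma; Manolescu–Piccirillo, arXiv:2102.04391v3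
  Lemma 3.7, and §1 p. 2: "pairs of knots with the same trace are not useful … the trace embedding lemma
  readily implies that if `K` is H-slice in some manifold `W`, then so is `K'`").
  Sandwich: `SmoothPoincare4 ⇒ ¬ ZseHsliceNotSlice ⇒ Assembly2 ⇔ ¬ ZseThesis` (the middle arrow is the
  contrapositive of `Theorems.ZseHsliceNotSlice.of_zseThesis` through `assembly2_iff_not_zseThesis`). The
  statement is symmetric in `K, K'`, so it equally says "smooth sliceness is an invariant of the `0`-surgery
  type" (`↔` form).
* `assembly2_iff_isConcordant` — **concordance form**: the item says exactly that every `0`-friend of a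
  smoothly slice knot is CONCORDANT to it (Fox–Milnor: concordant to slice is slice; two slice knots are
  concordant, both being concordant to the unknot — tree theorems
  `Knot.IsConcordant.isSmoothlySlice`, `Knot.isSmoothlySlice_iff_isConcordant_unknot_holds`,
  `equivalence_isConcordant_holds`). The unrestricted concordance statement ("`0`-friends are concordant",
  Akbulut–Kirby, Kirby list 1.19) is FALSE in print (Yasui 2015: non-concordant `0`-friends, both non-slice),
  so the restriction to a slice `K` is essential — it is where the item's entire content sits.

No definitions, no named facts, no `sorry`; nothing here concludes the item (it is `--supports` material;
the item's own signature stays open).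

## References

* C. Manolescu, L. Piccirillo, *From zero surgeries to candidates for exotic definite 4-manifolds*,
  J. Lond. Math. Soc. 108 (2023) = arXiv:2102.04391v3, §1 pp. 1–2, Lemma 3.3 (arXiv: Lemma 3.5), trace embedding
  lemma (arXiv: Lemma 3.7) [ManolescuPiccirillo2023].
* M. Freedman, R. Gompf, S. Morrison, K. Walker, *Man and machine thinking about the smooth 4-dimensional
  Poincaré conjecture*, Quantum Topol. 1 (2010), §2 p. 6 and Fact 2.1 [FreedmanGompfMorrisonWalker2010].
* R. H. Fox, J. W. Milnor, *Singularities of 2-spheres in 4-space and cobordism of knots*, Osaka J. Math. 3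
  (1966), §1 [FoxMilnor1966].
-/

noncomputable section

open scoped Manifold ContDiff
open ContinuousMap
open Literature.Topology.FourManifolds

-- `Summit.SmoothPoincare4.SmoothPoincare4.…` (single-conjunct summit, `<Problem> = <Summit>`) trips core's
-- `linter.dupNamespace` on every declaration when the file is elaborated outside Lake (the lakefile sets it off).
set_option linter.dupNamespace false

namespace Summit.SmoothPoincare4.SmoothPoincare4.Theorems.Assembly2

open Summit.SmoothPoincare4.SmoothPoincare4.Theses.ZeroSurgeryExotic

/-! ### The item is the negation of the route target -/

/-- **`Assembly2 ↔ ¬ ZseThesis`**: the kill switch (item 0367) is, after pushing the negation through the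
quantifiers, exactly the negation of the route target (item 0364). [folklore] -/
theorem assembly2_iff_not_zseThesis : Assembly2 ↔ ¬ ZseThesis := by
  constructor
  · rintro h ⟨K, K', Y, _, _, h1, h2, h3, h4⟩
    exact h4 (h K K' Y h1 h2 h3)
  · intro h K K' Y _ _ h1 h2 h3
    by_contra h4
    exact h ⟨K, K', Y, _, _, h1, h2, h3, h4⟩

/-- **The kill edge**: a proof of the item refutes the route target (the route's kill criterion
"`Assembly2` proved ⇒ close `refuted:ZseThesis`", as a theorem). [folklore] -/
theorem not_zseThesis_of_assembly2 (h : Assembly2) : ¬ ZseThesis :=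
  assembly2_iff_not_zseThesis.1 h

/-! ### Concordance form of the item -/

/-- Two smoothly slice knots are concordant: each is concordant to the unknot (Fox–Milnor; tree theorems
`Knot.isSmoothlySlice_iff_isConcordant_unknot_holds`, `equivalence_isConcordant_holds`). [cite: FoxMilnor1966, §1] -/
theorem isConcordant_of_isSmoothlySlice {K K' : Knot} (hK : K.IsSmoothlySlice) (hK' : K'.IsSmoothlySlice) :
    K'.IsConcordant K :=
  equivalence_isConcordant_holds.trans (Knot.isSmoothlySlice_iff_isConcordant_unknot_holds.1 hK')
    (equivalence_isConcordant_holds.symm (Knot.isSmoothlySlice_iff_isConcordant_unknot_holds.1 hK))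

/-- **Concordance form of the item: every `0`-friend of a smoothly slice knot is concordant to it.**
(`→`: the friend is slice by the item, and two slice knots are concordant; `←`: concordant to slice is
slice, `Knot.IsConcordant.isSmoothlySlice`, Fox–Milnor.) The UNRESTRICTED statement "knots with the same
`0`-surgery are concordant" (Kirby list, Problem 1.19) is false — Yasui (2015) gave non-concordant
`0`-friends, both non-slice — so the hypothesis `K.IsSmoothlySlice` carries the whole content: the item is
the slice corner of Problem 1.19, open in print. [cite: FoxMilnor1966, §1] -/
theorem assembly2_iff_isConcordant :
    Assembly2 ↔ ∀ (K K' : Knot) (Y : Type) [TopologicalSpace Y]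
      [ChartedSpace (EuclideanSpace ℝ (Fin 3)) Y], IsIntegralSurgery (𝓡 3) Y K 0 →
        IsIntegralSurgery (𝓡 3) Y K' 0 → K.IsSmoothlySlice → K'.IsConcordant K :=
  ⟨fun h K K' Y _ _ h1 h2 h3 ↦ isConcordant_of_isSmoothlySlice h3 (h K K' Y h1 h2 h3),
    fun h K K' Y _ _ h1 h2 h3 ↦ (h K K' Y h1 h2 h3).isSmoothlySlice h3⟩

/-! ### Above the item: the summit -/

/-- **Under `SmoothPoincare4`, every `0`-friend of a smoothly slice knot is concordant to it.** On a
`0`-surgery pair with `K` slice, `K'` is slice in a homotopy `4`-ball (Manolescu–Piccirillo Lemma 3.3 for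
`W = S⁴`, proved in the tree: `Literature.Uncategorized.isHomotopyBallSlice_of_zeroSurgeryPair` over
`Knot.ManolescuPiccirillo2023_lemma33_sphere_holds`), therefore slice under SPC4 (contrapositive FGMW lemma
via Palais, proved in the tree: `ZseSVanishesOnPairs.Negative.isSmoothlySlice_of_isHomotopyBallSlice_of_spc4`
over `Knot.exists_exotic_of_isHomotopyBallSlice_not_isSmoothlySlice_holds`), therefore concordant to `K`
(`isConcordant_of_isSmoothlySlice`). [cite: ManolescuPiccirillo2023, §1 p. 1 and Lemma 3.3] -/
theorem isConcordant_friend_of_smoothPoincare4 (hS : _root_.SmoothPoincare4) {K K' : Knot} {Y : Type}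
    [TopologicalSpace Y] [ChartedSpace (EuclideanSpace ℝ (Fin 3)) Y] (h1 : IsIntegralSurgery (𝓡 3) Y K 0)
    (h2 : IsIntegralSurgery (𝓡 3) Y K' 0) (h3 : K.IsSmoothlySlice) : K'.IsConcordant K :=
  isConcordant_of_isSmoothlySlice h3
    (ZseSVanishesOnPairs.Negative.isSmoothlySlice_of_isHomotopyBallSlice_of_spc4 hS
      (Literature.Uncategorized.isHomotopyBallSlice_of_zeroSurgeryPair h1 h2 h3))

/-- **`SmoothPoincare4 → Assembly2`: the item holds conditionally on the summit statement** (and is thereby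
NOT settled — its own signature stays open): by `isConcordant_friend_of_smoothPoincare4` and the concordance
form `assembly2_iff_isConcordant`. Nothing weaker than SPC4 that implies the item is known in print; only the
`0`-trace analogue (trace embedding lemma) is a theorem, and by `not_zseThesis_of_assembly2` with the route's
assembly (item 0365, `Theorems.assembly_proof`) a refutation of the item would refute SPC4.
[cite: ManolescuPiccirillo2023, §1 pp. 1–2 and Lemma 3.3] -/
theorem assembly2_of_smoothPoincare4 (hS : _root_.SmoothPoincare4) : Assembly2 :=
  assembly2_iff_isConcordant.2 fun _ _ _ _ _ h1 h2 h3 ↦ isConcordant_friend_of_smoothPoincare4 hS h1 h2 h3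

end Summit.SmoothPoincare4.SmoothPoincare4.Theorems.Assembly2

end
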